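import Summits.NavierStokesRegularity.FunctionalMining.HsSaturatingLawReduction
import Literature.Analysis.FunctionSpaces.TorusAgmonExplicit
import HarnessLib

/-!
# FunctionalMining — the static production estimate of the family `EF.s` holds at `s = 1` (anchor)

Search for candidate a priori estimates; no regularity claim. Cell `pub-nsfunc`, prove seat
(gen 11). The typed located gap `HsProductionBound s C` of `HsSaturatingLawReduction`
(`|N_s(v)| ≤ C (2ℰ)^{(2s−1)/(4s)} E_s^{1/2} E_{s+1}^{(2s+1)/(4s)}`) is PROVED at `s = 1` with the explicit
constant `C = 2 (4/π⁴)^{1/4} = 2√2/π`: there `N_1(v) = 2∫⟪Δv, (v·∇)v⟫`, `E_1 = 2ℰ = ‖∇v‖₂²`,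
`E_2 = ‖Δv‖₂²`, and the estimate is the Lu–Doering chain of the tree
(`ExtremeGrowthBoundsProofs`): Cauchy–Schwarz `|∫⟪(v·∇)v, Δv⟫| ≤ ‖v‖_∞ ‖∇v‖₂ ‖Δv‖₂` and Agmon's
inequality with the explicit constant `‖v‖_∞⁴ ≤ (4/π⁴)‖∇v‖₂²‖Δv‖₂²` for zero-mean fields on `T³`
(`Torus.norm_pow_four_le_agmon_explicit`). Consequently the `s = 1` instance of the conditional
rows is unconditional: `SaturatingLaw (torusHsEnergy 1) 1 3 κ` (the Lu–Doering law for `E_1 = 2ℰ`,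
`hsEnergy_saturatingLaw_one`) — the anchor showing that the reduction of the rows `EF.s=3/4, 5/4, 3/2`
to `HsProductionBound` is the right shape. A priori inequality along smooth solutions; small-data
closing only. Also: `HsProductionBound.mono` and the conditional Lyapunov mirror
`EK.EF.s=3/2 | T_M0` (`hsEnergy_lyapunov_three_halves_of_bound`, via `SaturatingLaw.antitoneOn_lyapunov`).
-/

noncomputable section

open MeasureTheory Set Filter Topology Function Real
open scoped InnerProductSpace RealInnerProductSpace

namespace Summit.NavierStokesRegularity.FunctionalMining

open Literature.Analysis Literature.Analysis.FunctionSpaces Literature.Analysis.FluidPDE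
open Literature.Analysis.FunctionSpaces.Torus Literature.Analysis.FluidPDE.Torus

/-! ## 1. `E_2 = ‖Δv‖₂²` and `N_1 = 2∫⟪Δv, (v·∇)v⟫` -/

/-- **`E_2(v) = ‖Δv‖₂²`** for smooth `v` (`(-Δ)² = (-Δ)^1 (-Δ)^1`, symmetry, `(-Δ)^1 = −Δ`). [folklore] -/
theorem torusHsEnergy_two {d : Type*} [Fintype d] [DecidableEq d]
    {v : UnitAddTorus d → EuclideanSpace ℝ d} (hv : IsSmooth v) :
    torusHsEnergy 2 v = ∫ x, ‖Torus.laplacian v x‖ ^ 2 := by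
  unfold torusHsEnergy
  have h11 : fracLaplacian 2 v = fracLaplacian 1 (fracLaplacian 1 v) := by
    rw [fracLaplacian_fracLaplacian zero_le_one zero_le_one hv]; norm_num
  rw [h11, ← integral_inner_fracLaplacian_comm zero_le_one hv (hv.fracLaplacian zero_le_one),
    fracLaplacian_one hv]
  refine integral_congr_ae (ae_of_all _ fun x => ?_)
  simp only [Pi.neg_apply, inner_neg_left, inner_neg_right, neg_neg, real_inner_self_eq_norm_sq]

/-- **`N_1(v) = 2∫⟪Δv, (v·∇)v⟫`** for smooth `v`. [folklore] -/
theorem hsInertialRate_one {d : Type*} [Fintype d] [DecidableEq d]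
    {v : UnitAddTorus d → EuclideanSpace ℝ d} (hv : IsSmooth v) :
    hsInertialRate 1 v = 2 * ∫ x, ⟪Torus.laplacian v x, Torus.convect v v x⟫_ℝ := by
  unfold hsInertialRate
  rw [fracLaplacian_one hv]
  simp only [Pi.neg_apply, inner_neg_left, integral_neg]
  ring

/-! ## 2. Cauchy–Schwarz for the convective term against the Laplacian -/

/-- **`|∫⟪Δv, (v·∇)v⟫| ≤ M ‖∇v‖₂ ‖Δv‖₂`** for a smooth field with `‖v(x)‖ ≤ M` everywhere
(`‖(v·∇)v‖ ≤ ‖v‖ (∑ᵢ‖∂ᵢv‖²)^{1/2}` pointwise, Cauchy–Schwarz in `L²`; Doering 2009 §3, Ayala 2014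
App. A (A.7) — the tree's private `integral_inner_convect_laplacian_le`, two-sided). [folklore] -/
theorem abs_integral_inner_laplacian_convect_le {d : Type*} [Fintype d] [DecidableEq d]
    {v : UnitAddTorus d → EuclideanSpace ℝ d} (hv : IsSmooth v) {M : ℝ} (hM0 : 0 ≤ M)
    (hM : ∀ x, ‖v x‖ ≤ M) :
    |∫ x, ⟪Torus.laplacian v x, Torus.convect v v x⟫_ℝ| ≤
      M * Real.sqrt (Torus.gradNormSq v) * Real.sqrt (∫ x, ‖Torus.laplacian v x‖ ^ 2) := by
  set g : UnitAddTorus d → ℝ := fun x => Real.sqrt (∑ i, ‖Torus.partialDeriv i v x‖ ^ 2) with hg_def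
  set h : UnitAddTorus d → ℝ := fun x => ‖Torus.laplacian v x‖ with hh_def
  have hθs : IsSmooth (fun x => ∑ i, ‖Torus.partialDeriv i v x‖ ^ 2) :=
    Torus.isSmooth_sum_norm_sq_partialDeriv hv
  have hgc : Continuous g := hθs.continuous.sqrt
  have hhc : Continuous h := hv.laplacian.continuous.norm
  have hg0 : ∀ x, 0 ≤ g x := fun x => Real.sqrt_nonneg _
  have hh0 : ∀ x, 0 ≤ h x := fun x => norm_nonneg _
  -- pointwise: `‖(v·∇)v‖ ≤ ‖v‖ g`
  have hconv : ∀ x, ‖Torus.convect v v x‖ ≤ ‖v x‖ * g x := by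
    intro x
    have h1 : Torus.convect v v x = ∑ i, (v x) i • Torus.partialDeriv i v x :=
      Torus.fderiv_apply_eq_sum_partialDeriv (hv.isContDiff (by simp)) x (v x)
    rw [h1]
    calc ‖∑ i, (v x) i • Torus.partialDeriv i v x‖
        ≤ ∑ i, ‖(v x) i • Torus.partialDeriv i v x‖ := norm_sum_le _ _
      _ = ∑ i, |(v x) i| * ‖Torus.partialDeriv i v x‖ := by
          refine Finset.sum_congr rfl fun i _ => ?_
          rw [norm_smul, Real.norm_eq_abs]
      _ ≤ Real.sqrt (∑ i, |(v x) i| ^ 2) * Real.sqrt (∑ i, ‖Torus.partialDeriv i v x‖ ^ 2) :=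
          Real.sum_mul_le_sqrt_mul_sqrt _ _ _
      _ = ‖v x‖ * g x := by
          rw [EuclideanSpace.norm_eq]
          simp only [Real.norm_eq_abs, hg_def]
  -- pointwise: `|⟪Δv, (v·∇)v⟫| ≤ M g h`
  have hpt : ∀ x, |⟪Torus.laplacian v x, Torus.convect v v x⟫_ℝ| ≤ M * (g x * h x) := by
    intro x
    calc |⟪Torus.laplacian v x, Torus.convect v v x⟫_ℝ|
        ≤ ‖Torus.laplacian v x‖ * ‖Torus.convect v v x‖ := abs_real_inner_le_norm _ _
      _ ≤ h x * (‖v x‖ * g x) := mul_le_mul_of_nonneg_left (hconv x) (norm_nonneg _)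
      _ ≤ h x * (M * g x) :=
          mul_le_mul_of_nonneg_left (mul_le_mul_of_nonneg_right (hM x) (hg0 x)) (hh0 x)
      _ = M * (g x * h x) := by ring
  -- Cauchy–Schwarz in `L²(T^d)`
  have hgm : MemLp g (ENNReal.ofReal 2) volume :=
    hgc.memLp_of_hasCompactSupport (HasCompactSupport.of_compactSpace g)
  have hhm : MemLp h (ENNReal.ofReal 2) volume :=
    hhc.memLp_of_hasCompactSupport (HasCompactSupport.of_compactSpace h)
  have hcs := integral_mul_le_Lp_mul_Lq_of_nonneg (μ := volume) Real.HolderConjugate.two_two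
    (ae_of_all _ hg0) (ae_of_all _ hh0) hgm hhm
  have e1 : ∫ x, g x ^ (2 : ℝ) = Torus.gradNormSq v := by
    rw [Torus.gradNormSq]
    exact integral_congr_ae (ae_of_all _ fun x => by
      dsimp only
      rw [Real.rpow_two, hg_def, Real.sq_sqrt (Finset.sum_nonneg fun i _ => sq_nonneg _)])
  have e2 : ∫ x, h x ^ (2 : ℝ) = ∫ x, ‖Torus.laplacian v x‖ ^ 2 :=
    integral_congr_ae (ae_of_all _ fun x => by dsimp only; rw [Real.rpow_two])
  rw [e1, e2, ← Real.sqrt_eq_rpow, ← Real.sqrt_eq_rpow] at hcs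
  have hint2 : Integrable (fun x => M * (g x * h x)) volume :=
    ((hgc.mul hhc).integrable_unitAddTorus).const_mul M
  calc |∫ x, ⟪Torus.laplacian v x, Torus.convect v v x⟫_ℝ|
      ≤ ∫ x, |⟪Torus.laplacian v x, Torus.convect v v x⟫_ℝ| := by
        have := norm_integral_le_integral_norm (μ := volume)
          (fun x => ⟪Torus.laplacian v x, Torus.convect v v x⟫_ℝ)
        simpa only [Real.norm_eq_abs] using this
    _ ≤ ∫ x, M * (g x * h x) :=
        integral_mono_of_nonneg (ae_of_all _ fun x => abs_nonneg _) hint2 (ae_of_all _ hpt)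
    _ = M * ∫ x, g x * h x := integral_const_mul _ _
    _ ≤ M * (Real.sqrt (Torus.gradNormSq v) * Real.sqrt (∫ x, ‖Torus.laplacian v x‖ ^ 2)) :=
        mul_le_mul_of_nonneg_left hcs hM0
    _ = M * Real.sqrt (Torus.gradNormSq v) * Real.sqrt (∫ x, ‖Torus.laplacian v x‖ ^ 2) := by
        ring

/-! ## 3. The production estimate at `s = 1` -/

/-- **`HsProductionBound 1 (2 (4/π⁴)^{1/4})` holds**: for smooth divergence-free zero-mean `v` on `T³`,
`|N_1(v)| ≤ 2 (4/π⁴)^{1/4} (2ℰ)^{1/4} E_1^{1/2} E_2^{3/4}` (`= (2√2/π) ‖∇v‖₂^{3/2} ‖Δv‖₂^{3/2}`;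
Cauchy–Schwarz + Agmon with the explicit constant). [ours; Lu–Doering chain with tree inputs] -/
theorem hsProductionBound_one : HsProductionBound 1 (2 * (4 / π ^ 4) ^ (1 / 4 : ℝ)) := by
  intro v hv hdiv hmean
  -- the sup bound from Agmon
  set A : ℝ := Torus.gradNormSq v with hA
  set P : ℝ := ∫ x, ‖Torus.laplacian v x‖ ^ 2 with hP
  have hA0 : 0 ≤ A := by rw [hA, Torus.gradNormSq]; positivity
  have hP0 : 0 ≤ P := by rw [hP]; positivity
  have hc0 : (0 : ℝ) ≤ 4 / π ^ 4 := by positivity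
  set M : ℝ := (4 / π ^ 4 * A * P) ^ (1 / 4 : ℝ) with hM
  have hR0 : 0 ≤ 4 / π ^ 4 * A * P := by positivity
  have hM0 : 0 ≤ M := Real.rpow_nonneg hR0 _
  have hsup : ∀ x, ‖v x‖ ≤ M := by
    intro x
    have h4 := norm_pow_four_le_agmon_explicit (by simp) hv hmean x
    rw [← hA, ← hP] at h4
    have h5 : (‖v x‖ ^ 4) ^ (1 / 4 : ℝ) ≤ (4 / π ^ 4 * A * P) ^ (1 / 4 : ℝ) :=
      Real.rpow_le_rpow (by positivity) h4 (by norm_num)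
    have h6 : (‖v x‖ ^ 4) ^ (1 / 4 : ℝ) = ‖v x‖ := by
      rw [show (1 / 4 : ℝ) = ((4 : ℕ) : ℝ)⁻¹ by norm_num,
        Real.pow_rpow_inv_natCast (norm_nonneg _) (by norm_num)]
    rw [h6] at h5
    exact h5
  have hCS := abs_integral_inner_laplacian_convect_le hv hM0 hsup
  -- rewrite the functionals
  have hE1 : torusHsEnergy 1 v = A := by rw [torusHsEnergy_one hv, hA]
  have hE2 : torusHsEnergy (1 + 1) v = P := by rw [show (1 : ℝ) + 1 = 2 by norm_num, torusHsEnergy_two hv, hP]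
  have h2E : 2 * torusEnstrophy v = A := by rw [torusEnstrophy, hA]; ring
  rw [hsInertialRate_one hv, hE1, hE2, h2E, abs_mul, abs_two]
  norm_num
  -- `2|X| ≤ 2 M √A √P = C A^{1/4} A^{1/2} P^{3/4}`
  have hM' : M = (4 / π ^ 4) ^ (1 / 4 : ℝ) * A ^ (1 / 4 : ℝ) * P ^ (1 / 4 : ℝ) := by
    rw [hM, Real.mul_rpow (mul_nonneg hc0 hA0) hP0, Real.mul_rpow hc0 hA0]
  have hsqA : Real.sqrt A = A ^ (1 / 2 : ℝ) := Real.sqrt_eq_rpow A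
  have hsqP : Real.sqrt P = P ^ (1 / 2 : ℝ) := Real.sqrt_eq_rpow P
  have hP34 : P ^ (1 / 4 : ℝ) * P ^ (1 / 2 : ℝ) = P ^ (3 / 4 : ℝ) := by
    rw [← Real.rpow_add' hP0 (by norm_num)]; norm_num
  calc 2 * |∫ x, ⟪Torus.laplacian v x, Torus.convect v v x⟫_ℝ|
      ≤ 2 * (M * Real.sqrt A * Real.sqrt P) := by linarith [hCS]
    _ = 2 * (4 / π ^ 4) ^ (1 / 4 : ℝ) * A ^ (1 / 4 : ℝ) * A ^ (1 / 2 : ℝ) *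
          (P ^ (1 / 4 : ℝ) * P ^ (1 / 2 : ℝ)) := by rw [hM', hsqA, hsqP]; ring
    _ = 2 * (4 / π ^ 4) ^ (1 / 4 : ℝ) * A ^ (1 / 4 : ℝ) * A ^ (1 / 2 : ℝ) * P ^ (3 / 4 : ℝ) := by
          rw [hP34]

/-- **The `s = 1` anchor of the family, unconditional**: `SaturatingLaw (torusHsEnergy 1) 1 3 κ` on `T³`
for SOME `κ` (the statement is existential; the chain gives `κ = (2(4/π⁴)^{1/4})⁴ = 64/π⁴`, not
recorded in the type) — the Lu–Doering law for `E_1 = 2ℰ = ‖∇u‖₂²` through the `EF.s` reduction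
(`saturatingLaw_torusHsEnergy_of_productionBound` at `s = 1`). [ours] -/
theorem hsEnergy_saturatingLaw_one :
    ∃ κ : ℝ, SaturatingLaw (d := Fin 3) (torusHsEnergy 1) 1 3 κ := by
  obtain ⟨κ, hκ⟩ := exists_saturatingLaw_torusHsEnergy_of_productionBound (s := 1) (by norm_num)
    (by positivity) hsProductionBound_one
  have e2 : ((2 : ℝ) * 1 + 1) / (2 * 1 - 1) = 3 := by norm_num
  have e1 : (2 : ℝ) * 1 - 1 = 1 := by norm_num
  rw [e2, e1] at hκ
  exact ⟨κ, hκ⟩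

/-! ## 4. Monotonicity in the constant and the conditional Lyapunov mirror `EK.EF.s=3/2 | T_M0` -/

/-- The production estimate is monotone in its constant (`s ≥ 0`). [ours] -/
theorem HsProductionBound.mono {s C C' : ℝ} (h : HsProductionBound s C) (hCC' : C ≤ C') (hs : 0 ≤ s) :
    HsProductionBound s C' := by
  intro v hv hdiv hmean
  refine (h v hv hdiv hmean).trans ?_
  have hA : 0 ≤ (2 * torusEnstrophy v) ^ ((2 * s - 1) / (4 * s)) :=
    Real.rpow_nonneg (mul_nonneg (by norm_num) (torusEnstrophy_nonneg v)) _
  have hB : 0 ≤ torusHsEnergy s v ^ (1 / 2 : ℝ) := Real.rpow_nonneg (torusHsEnergy_nonneg hs hv) _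
  have hD : 0 ≤ torusHsEnergy (s + 1) v ^ ((2 * s + 1) / (4 * s)) :=
    Real.rpow_nonneg (torusHsEnergy_nonneg (by linarith) hv) _
  have hX : 0 ≤ (2 * torusEnstrophy v) ^ ((2 * s - 1) / (4 * s)) * torusHsEnergy s v ^ (1 / 2 : ℝ) *
      torusHsEnergy (s + 1) v ^ ((2 * s + 1) / (4 * s)) := mul_nonneg (mul_nonneg hA hB) hD
  calc C * (2 * torusEnstrophy v) ^ ((2 * s - 1) / (4 * s)) * torusHsEnergy s v ^ (1 / 2 : ℝ) *
        torusHsEnergy (s + 1) v ^ ((2 * s + 1) / (4 * s))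
      = C * ((2 * torusEnstrophy v) ^ ((2 * s - 1) / (4 * s)) * torusHsEnergy s v ^ (1 / 2 : ℝ) *
          torusHsEnergy (s + 1) v ^ ((2 * s + 1) / (4 * s))) := by ring
    _ ≤ C' * ((2 * torusEnstrophy v) ^ ((2 * s - 1) / (4 * s)) * torusHsEnergy s v ^ (1 / 2 : ℝ) *
          torusHsEnergy (s + 1) v ^ ((2 * s + 1) / (4 * s))) := mul_le_mul_of_nonneg_right hCC' hX
    _ = _ := by ring

/-- **Row `EK.EF.s=3/2 | T_M0` conditional on `HsProductionBound (3/2) C`**: there is `κ > 0` such that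
`K − (2/κ) ν³ E_{3/2}^{−1/2}` is antitone on every positive-`E_{3/2}` window of a zero-mean classical
solution on `T³` (the law at `(σ, γ) = (2, 2)` with the constant raised to `max C 1`, and
`SaturatingLaw.antitoneOn_lyapunov`). Conditional; nothing asserted. [ours] -/
theorem hsEnergy_lyapunov_three_halves_of_bound {C : ℝ} (h : HsProductionBound (3 / 2) C) :
    ∃ κ : ℝ, 0 < κ ∧ ∀ {ν a b : ℝ}, 0 < ν → a < b →
      ∀ {u : ℝ → UnitAddTorus (Fin 3) → EuclideanSpace ℝ (Fin 3)} {p : ℝ → UnitAddTorus (Fin 3) → ℝ},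
        Torus.IsClassicalNSSolutionOn (Icc a b) ν 0 u p →
        (∀ t ∈ Icc a b, Torus.HasZeroMean (u t)) →
        (∀ t ∈ Icc a b, 0 < torusHsEnergy (3 / 2) (u t)) →
        AntitoneOn (fun t => Torus.kineticEnergy (u t) -
            2 / κ * ν ^ ((2 : ℝ) + 1) * torusHsEnergy (3 / 2) (u t) ^ (-(2 : ℝ)⁻¹)) (Icc a b) := by
  have hC' : 0 < max C 1 := lt_of_lt_of_le one_pos (le_max_right _ _)
  have h' : HsProductionBound (3 / 2) (max C 1) := h.mono (le_max_left C 1) (by norm_num)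
  have hlaw := saturatingLaw_torusHsEnergy_of_productionBound (s := 3 / 2) (by norm_num) hC'.le h'
  have e2 : ((2 : ℝ) * (3 / 2) + 1) / (2 * (3 / 2) - 1) = 2 := by norm_num
  have e1 : (2 : ℝ) * (3 / 2) - 1 = 2 := by norm_num
  rw [e2, e1] at hlaw
  refine ⟨(max C 1) ^ (4 * (3 / 2 : ℝ) / 2), Real.rpow_pos_of_pos hC' _,
    fun hν hab u p hsol hmean hpos => ?_⟩
  exact hlaw.antitoneOn_lyapunov (by norm_num) (Real.rpow_pos_of_pos hC' _) (by simp) hν hab hsol hmean hpos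

end Summit.NavierStokesRegularity.FunctionalMining
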